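import Summits.Ventures.HSemireg.WedgeHankelRecurrenceInertia
import Summits.Ventures.HSemireg.WedgeHankelRecurrenceCommonRoots

/-!
# Venture HSemireg — HERMITE–SYLVESTER ROOT COUNTING BY SIGNATURE, SPLIT CASE OVER ANY ORDERED FIELD: for `m` monic and split over an ordered field `K`, `deg m ≤ t + 1`, and any weight `a ∈ K[X]`, the
# Hankel form `vᵀ H_t(a·m′/m) v` of the symbol `dualSeq m (a m′)` (= `(Tr L_{a X^{i+j}})_{i,j}` = Hermite's `Her(m, a)`) has **`sigPos = #{λ root of m | a(λ) > 0}`, `sigNeg = #{λ | a(λ) < 0}`, signature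
# `sigPos − sigNeg = Σ_λ sign a(λ) = TaQ(a, m)`**, is positive semi-definite for `a = 1` with `sigPos = #(distinct roots)`, and for `deg m = t + 1` its inertia rank `sigPos + sigNeg` is N113's matrix rank

HONEST FRAMING. Part of the Lean index of the computation cell `pub-hsemireg` (seat p10 gen 33, Sunday typer «UNIFORM-IN-n»).
LINEAR ALGEBRA OF HANKEL (catalecticant) MATRICES and of polynomials over a field ONLY (`Polynomial.roots`, `Polynomial.Splits`, Mathlib's `sigPos` ∕ `sigNeg`, `Matrix.toQuadraticForm'`): no variety,
no cohomology theory, no sheaf, no Ext group and no semiregularity map is constructed here; nothing here says that HC / HC_CM / HC_AV holds; no Literature fact is declared or used; no real closed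
field is assumed — the statements hold over every linearly ordered field for SPLIT `m` (the non-split real case is the CHAINED sibling leaf `WedgeHankelRecurrenceSignatureReal`).
SOURCE (classical, cited not used): Hermite 1853 ∕ Sylvester 1853; S. Basu, R. Pollack, M.-F. Roy, *Algorithms in Real Algebraic Geometry* (2nd ed. 2006) §4.3.2: «`Her(P,Q)(f) = Σ_{x ∈ Zer(P,C)}
μ(x) Q(x) (f_1 + f_2 x + ⋯ + f_p x^{p−1})²`», Proposition 4.55 (the matrix of `Her(P, Q)` is `(Tr L_{Q X^{k+j}})` = the coefficients of `P′Q/P` in `1/X` — here `dualSeq P (Q P′)`), **Theorem 4.57 (Hermite)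
«`Rank(Her(P,Q)) = #{x ∈ C | P(x) = 0 ∧ Q(x) ≠ 0}`, `Sign(Her(P,Q)) = TaQ(Q,P)`»**, of which this leaf is the case `Zer(P, C) = Zer(P, K)` (all roots in the ordered ground field).
DEDUP DISCLOSURE (`rg` of the whole tree): PROVED Literature `RingTheory/ZeroDimensional/HermiteForm.lean` (`sigPos_eq`, `sigNeg_eq`, `sigPos_sub_sigNeg_eq_sum_sign`) proves the same numbers for the
multivariate TRACE form `S_h` on `K[x]/I` under «all companion eigenvalues in `K`» — mathematically the present split case in the language `MvPolynomial σ K ⧸ I`, `Algebra.traceForm`; PROVED Literature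
`Algebra/Polynomial/TraceFormSignature.lean` is its radical sub-case; `Algebra/Polynomial/HermiteRankSignature.lean` is `Q = 1` over `ℝ` by eigenvalue counts.  The present leaf is the HANKEL-MATRIX
statement for `H_t(a·m′/m)` of any size `t + 1 ≥ deg m`, with weights and multiplicities, proved through N126's inertia-under-pull-back (not through a trace-form isometry); names and types are new.

WHAT IS IN THE TREE.  N126 (`WedgeHankelRecurrenceInertia`): `sigPos_toQuadraticForm'_hankelSq_of_eq_sum`, `sigNeg_…`, `sigPos_sub_sigNeg_…`, `sigPos_add_sigNeg_…`, `sigPos_toQuadraticForm'_hankelSq_of_eq_sum_of_pos`,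
`toQuadraticForm'_hankelSq_nonneg_of_eq_sum`.  N108 (`WedgeHankelRecurrenceSylvester`): `dualSeq_multiset_prod_X_sub_C_mul_derivative` (weighted power sums).  N113 (`WedgeHankelRecurrenceCommonRoots`):
`rank_hankelSq_dualSeq_mul_derivative_eq_card_filter`.  Mathlib: `Polynomial.Splits.eq_prod_roots_of_monic`, `Finset.sum_multiset_map_count`, `Polynomial.card_roots'`, `Multiset.toFinset_card_le`.
THIS FILE (namespace `Summit.Ventures.HSemireg.Wedge.HankelOuter` continued; CHAINED on N126, PLAIN on N113; 0 definitions):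
* §707 `dualSeq_mul_derivative_eq_sum_roots_toFinset` (split `m`: `dualSeq m (a m′) j = Σ_{λ ∈ roots} e_λ a(λ) λ^j`, distinct roots, multiplicities as weights), `toQuadraticForm'_hankelSq_dualSeq_mul_derivative_apply`
  (`vᵀ H_t(a m′/m) v = Σ_λ e_λ a(λ) (Σ_i v_i λ^i)²` — BPR's displayed `Her(P, Q)`).
* §708 **`sigPos_hankelSq_dualSeq_mul_derivative`**, **`sigNeg_hankelSq_dualSeq_mul_derivative`**, **`sigPos_sub_sigNeg_hankelSq_dualSeq_mul_derivative`** (`= Σ_λ sign a(λ)`), `sigPos_add_sigNeg_hankelSq_dualSeq_mul_derivative`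
  (`= #{λ | a(λ) ≠ 0}`), `sigPos_add_sigNeg_eq_rank` (`deg m = t + 1`: the inertia rank is N113's matrix rank), the case `a = 1`: `sigPos_hankelSq_dualSeq_derivative` (`= #(distinct roots)`, `sigNeg = 0`),
  `toQuadraticForm'_hankelSq_dualSeq_derivative_nonneg` (split ⇒ `H_t(m′/m) ⪰ 0`; the converse fails over non-real-closed ordered fields, e.g. `m = X² − 2` over `ℚ` has `H_1 = diag(2, 4) ≻ 0`).
Nothing Ext-side.  New names only.
-/

open Module Polynomial
open scoped Matrix Polynomial

namespace Summit.Ventures.HSemireg.Wedge.HankelOuter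

open Summit.Ventures.HSemireg.Wedge Summit.Ventures.HSemireg.Wedge.Hankel

variable (K : Type*) [Field K]

/-! ## §707. The symbol of a split polynomial is a finite sum of weighted geometric sequences -/

/-- **`m` monic and split ⇒ `dualSeq m (a·m′) j = Σ_{λ ∈ roots(m)} e_λ · a(λ) · λ^j`** (sum over the DISTINCT roots, `e_λ` the multiplicity): N108's weighted power sums over the multiset of roots, regrouped.
[this file, §707] -/
theorem dualSeq_mul_derivative_eq_sum_roots_toFinset [DecidableEq K] {m : K[X]} (hm : m.Monic) (hs : m.Splits) (a : K[X]) (j : ℕ) :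
    dualSeq K m (a * derivative m) j = ∑ c ∈ m.roots.toFinset, ((m.roots.count c : ℕ) : K) * a.eval c * c ^ j := by
  have hprod : m = (m.roots.map fun c => Polynomial.X - C c).prod := hs.eq_prod_roots_of_monic hm
  have h := dualSeq_multiset_prod_X_sub_C_mul_derivative K m.roots a
  rw [← hprod] at h
  rw [h]
  dsimp only
  rw [Finset.sum_multiset_map_count]
  exact Finset.sum_congr rfl fun c _ => by rw [nsmul_eq_mul, mul_assoc]

/-- **Hermite's form displayed: `vᵀ H_t(a·m′/m) v = Σ_{λ ∈ roots(m)} e_λ a(λ) (Σ_i v_i λ^i)²`** for split monic `m` («`Her(P,Q)(f) = Σ_x μ(x) Q(x) (f_1 + f_2 x + ⋯)²`»). [this file, §707] -/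
theorem toQuadraticForm'_hankelSq_dualSeq_mul_derivative_apply [DecidableEq K] {m : K[X]} (hm : m.Monic) (hs : m.Splits) (a : K[X]) (t : ℕ) (v : Fin (t + 1) → K) :
    (hankelSq K t (dualSeq K m (a * derivative m))).toQuadraticForm' v = ∑ c ∈ m.roots.toFinset, ((m.roots.count c : ℕ) : K) * a.eval c * (∑ i : Fin (t + 1), v i * c ^ (i : ℕ)) ^ 2 :=
  toQuadraticForm'_hankelSq_eq_sum_mul_sq K m.roots.toFinset id (fun c => ((m.roots.count c : ℕ) : K) * a.eval c) (fun j => by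
    simp only [id_eq]; exact dualSeq_mul_derivative_eq_sum_roots_toFinset K hm hs a j) v

/-- The number of distinct roots is at most `t + 1` once `deg m ≤ t + 1`. [bookkeeping] -/
theorem card_roots_toFinset_le_of_natDegree_le [DecidableEq K] {m : K[X]} {t : ℕ} (hmd : m.natDegree ≤ t + 1) : m.roots.toFinset.card ≤ t + 1 :=
  (Multiset.toFinset_card_le _).trans ((Polynomial.card_roots' m).trans hmd)

/-! ## §708. Hermite–Sylvester: the inertia of `H_t(a·m′/m)` counts the roots with the sign of `a` -/

section Ordered

variable {K} [LinearOrder K] [IsStrictOrderedRing K] [DecidableEq K]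

/-- On the distinct roots the multiplicity weight is positive, so the sign of `e_λ a(λ)` is the sign of `a(λ)`. [bookkeeping] -/
theorem filter_count_mul_eval_pos_eq {m : K[X]} (a : K[X]) :
    (m.roots.toFinset.filter fun c => 0 < ((m.roots.count c : ℕ) : K) * a.eval c) = m.roots.toFinset.filter fun c => 0 < a.eval c := by
  refine Finset.filter_congr fun c hc => ?_
  have hpos : 0 < ((m.roots.count c : ℕ) : K) := Nat.cast_pos.2 (Multiset.count_pos.2 (Multiset.mem_toFinset.1 hc))
  exact mul_pos_iff_of_pos_left hpos

/-- The same for negative values. [bookkeeping] -/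
theorem filter_count_mul_eval_neg_eq {m : K[X]} (a : K[X]) :
    (m.roots.toFinset.filter fun c => ((m.roots.count c : ℕ) : K) * a.eval c < 0) = m.roots.toFinset.filter fun c => a.eval c < 0 := by
  refine Finset.filter_congr fun c hc => ?_
  have hpos : 0 < ((m.roots.count c : ℕ) : K) := Nat.cast_pos.2 (Multiset.count_pos.2 (Multiset.mem_toFinset.1 hc))
  rw [← neg_pos, ← mul_neg, mul_pos_iff_of_pos_left hpos, neg_pos]

/-- **HERMITE–SYLVESTER, positive index: for `m` monic, split over the ordered field `K`, `deg m ≤ t + 1`, and any `a`, `sigPos (vᵀ H_t(a·m′/m) v) = #{λ ∈ roots(m) | a(λ) > 0}`.**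
[this file, §708; BPR Thm. 4.57 for `Zer(P, C) ⊆ K`] -/
theorem sigPos_hankelSq_dualSeq_mul_derivative {t : ℕ} {m : K[X]} (hm : m.Monic) (hs : m.Splits) (hmd : m.natDegree ≤ t + 1) (a : K[X]) :
    sigPos (hankelSq K t (dualSeq K m (a * derivative m))).toQuadraticForm' = (m.roots.toFinset.filter fun c => 0 < a.eval c).card := by
  rw [sigPos_toQuadraticForm'_hankelSq_of_eq_sum m.roots.toFinset (fun c => ((m.roots.count c : ℕ) : K) * a.eval c) (card_roots_toFinset_le_of_natDegree_le K hmd)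
    (dualSeq_mul_derivative_eq_sum_roots_toFinset K hm hs a), filter_count_mul_eval_pos_eq]

/-- **HERMITE–SYLVESTER, negative index: `sigNeg (vᵀ H_t(a·m′/m) v) = #{λ ∈ roots(m) | a(λ) < 0}`.** [this file, §708] -/
theorem sigNeg_hankelSq_dualSeq_mul_derivative {t : ℕ} {m : K[X]} (hm : m.Monic) (hs : m.Splits) (hmd : m.natDegree ≤ t + 1) (a : K[X]) :
    sigNeg (hankelSq K t (dualSeq K m (a * derivative m))).toQuadraticForm' = (m.roots.toFinset.filter fun c => a.eval c < 0).card := by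
  rw [sigNeg_toQuadraticForm'_hankelSq_of_eq_sum m.roots.toFinset (fun c => ((m.roots.count c : ℕ) : K) * a.eval c) (card_roots_toFinset_le_of_natDegree_le K hmd)
    (dualSeq_mul_derivative_eq_sum_roots_toFinset K hm hs a), filter_count_mul_eval_neg_eq]

/-- **HERMITE–SYLVESTER, signature = Tarski query: `sigPos − sigNeg = Σ_{λ ∈ roots(m)} sign a(λ) = #{a > 0} − #{a < 0}`** (`m` monic split, `deg m ≤ t + 1`; «`Sign(Her(P,Q)) = TaQ(Q,P)`» with all roots in `K`).
[this file, §708] -/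
theorem sigPos_sub_sigNeg_hankelSq_dualSeq_mul_derivative {t : ℕ} {m : K[X]} (hm : m.Monic) (hs : m.Splits) (hmd : m.natDegree ≤ t + 1) (a : K[X]) :
    (sigPos (hankelSq K t (dualSeq K m (a * derivative m))).toQuadraticForm' : ℤ) - sigNeg (hankelSq K t (dualSeq K m (a * derivative m))).toQuadraticForm'
      = ∑ c ∈ m.roots.toFinset, (SignType.sign (a.eval c) : ℤ) := by
  rw [sigPos_sub_sigNeg_toQuadraticForm'_hankelSq_of_eq_sum m.roots.toFinset (fun c => ((m.roots.count c : ℕ) : K) * a.eval c) (card_roots_toFinset_le_of_natDegree_le K hmd)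
    (dualSeq_mul_derivative_eq_sum_roots_toFinset K hm hs a)]
  refine Finset.sum_congr rfl fun c hc => ?_
  have hpos : 0 < ((m.roots.count c : ℕ) : K) := Nat.cast_pos.2 (Multiset.count_pos.2 (Multiset.mem_toFinset.1 hc))
  rw [sign_mul, sign_pos hpos, one_mul]

/-- **Inertia rank: `sigPos + sigNeg = #{λ ∈ roots(m) | a(λ) ≠ 0}`** («`Rank(Her(P,Q)) = #{x | P(x) = 0 ∧ Q(x) ≠ 0}`» for split `m`, as the rank of the form). [this file, §708] -/
theorem sigPos_add_sigNeg_hankelSq_dualSeq_mul_derivative {t : ℕ} {m : K[X]} (hm : m.Monic) (hs : m.Splits) (hmd : m.natDegree ≤ t + 1) (a : K[X]) :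
    sigPos (hankelSq K t (dualSeq K m (a * derivative m))).toQuadraticForm' + sigNeg (hankelSq K t (dualSeq K m (a * derivative m))).toQuadraticForm' = (m.roots.toFinset.filter fun c => a.eval c ≠ 0).card := by
  rw [sigPos_add_sigNeg_toQuadraticForm'_hankelSq_of_eq_sum m.roots.toFinset (fun c => ((m.roots.count c : ℕ) : K) * a.eval c) (card_roots_toFinset_le_of_natDegree_le K hmd)
    (dualSeq_mul_derivative_eq_sum_roots_toFinset K hm hs a)]
  congr 1
  refine Finset.filter_congr fun c hc => ?_
  have hpos : 0 < ((m.roots.count c : ℕ) : K) := Nat.cast_pos.2 (Multiset.count_pos.2 (Multiset.mem_toFinset.1 hc))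
  rw [mul_ne_zero_iff, and_iff_right hpos.ne']

/-- **For `deg m = t + 1` the inertia rank is the MATRIX rank of N113: `sigPos + sigNeg = rank H_t(a·m′/m)`** (an ordered field has characteristic `0`, so N113's multiplicity filter is void). [this file, §708] -/
theorem sigPos_add_sigNeg_eq_rank {t : ℕ} {m : K[X]} (hm : m.Monic) (hs : m.Splits) (hmd : m.natDegree = t + 1) (a : K[X]) :
    sigPos (hankelSq K t (dualSeq K m (a * derivative m))).toQuadraticForm' + sigNeg (hankelSq K t (dualSeq K m (a * derivative m))).toQuadraticForm' = (hankelSq K t (dualSeq K m (a * derivative m))).rank := by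
  rw [sigPos_add_sigNeg_hankelSq_dualSeq_mul_derivative hm hs hmd.le, rank_hankelSq_dualSeq_mul_derivative_eq_card_filter K hm hmd hs]
  congr 1
  refine Finset.filter_congr fun c hc => ?_
  have hpos : 0 < ((m.roots.count c : ℕ) : K) := Nat.cast_pos.2 (Multiset.count_pos.2 (Multiset.mem_toFinset.1 hc))
  rw [Polynomial.IsRoot.def, and_iff_right hpos.ne']

/-- **The unweighted Hermite form of a split polynomial: `sigPos (vᵀ H_t(m′/m) v) = #(distinct roots)` and `sigNeg = 0`** (`m` monic split, `deg m ≤ t + 1`; «the signature of `Her(P, 1)` is the number of roots of `P`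
in `R`», BPR Thm. 4.58, in the case all roots lie in `K`). [this file, §708] -/
theorem sigPos_hankelSq_dualSeq_derivative {t : ℕ} {m : K[X]} (hm : m.Monic) (hs : m.Splits) (hmd : m.natDegree ≤ t + 1) :
    sigPos (hankelSq K t (dualSeq K m (derivative m))).toQuadraticForm' = m.roots.toFinset.card ∧ sigNeg (hankelSq K t (dualSeq K m (derivative m))).toQuadraticForm' = 0 := by
  have h1 := sigPos_hankelSq_dualSeq_mul_derivative hm hs hmd 1
  have h2 := sigNeg_hankelSq_dualSeq_mul_derivative hm hs hmd 1
  rw [one_mul] at h1 h2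
  rw [h1, h2, Finset.card_eq_zero, Finset.filter_eq_empty_iff]
  refine ⟨congrArg Finset.card (Finset.filter_true_of_mem fun c _ => by rw [eval_one]; exact one_pos), fun c _ h => ?_⟩
  rw [eval_one] at h
  exact absurd h (not_lt.2 zero_le_one)

/-- **Split ⇒ `H_t(m′/m)` is positive semi-definite: `vᵀ H_t(m′/m) v = Σ_λ e_λ (Σ_i v_i λ^i)² ≥ 0`** over any ordered field (any `t`).  The converse holds over real closed fields only (PROVED Literature
`HermiteRealRootedness.splits_iff_posSemidef_hermiteMatrix` over `ℝ`); over `ℚ`, `m = X² − 2` gives `H_1(m′/m) = diag(2, 4) ≻ 0` without a rational root. [this file, §708] -/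
theorem toQuadraticForm'_hankelSq_dualSeq_derivative_nonneg {m : K[X]} (hm : m.Monic) (hs : m.Splits) (t : ℕ) (v : Fin (t + 1) → K) :
    0 ≤ (hankelSq K t (dualSeq K m (derivative m))).toQuadraticForm' v := by
  have h := toQuadraticForm'_hankelSq_nonneg_of_eq_sum m.roots.toFinset (w := fun c => ((m.roots.count c : ℕ) : K) * (1 : K[X]).eval c) (fun c _ => by
    rw [eval_one, mul_one]; exact Nat.cast_nonneg _) (q := dualSeq K m (1 * derivative m)) (dualSeq_mul_derivative_eq_sum_roots_toFinset K hm hs 1) v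
  rwa [one_mul] at h

/-- More generally **`a ≥ 0` on the roots ⇒ `H_t(a·m′/m) ⪰ 0`** (split monic `m`, any `t`). [this file, §708] -/
theorem toQuadraticForm'_hankelSq_dualSeq_mul_derivative_nonneg {m : K[X]} (hm : m.Monic) (hs : m.Splits) {a : K[X]} (ha : ∀ c ∈ m.roots, 0 ≤ a.eval c) (t : ℕ) (v : Fin (t + 1) → K) :
    0 ≤ (hankelSq K t (dualSeq K m (a * derivative m))).toQuadraticForm' v :=
  toQuadraticForm'_hankelSq_nonneg_of_eq_sum m.roots.toFinset (w := fun c => ((m.roots.count c : ℕ) : K) * a.eval c) (fun c hc => mul_nonneg (Nat.cast_nonneg _) (ha c (Multiset.mem_toFinset.1 hc)))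
    (dualSeq_mul_derivative_eq_sum_roots_toFinset K hm hs a) v

end Ordered

end Summit.Ventures.HSemireg.Wedge.HankelOuter
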